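import Literature.MathematicalPhysics.QuantumFieldTheory.Balaban1983to89.B15Prop1SliceTaylorCalculus

/-!
# `Balaban1983to89.B15Prop1SliceSecondDerivative` — [Balaban1989LargeFieldII] p. 359, (1.12): the SECOND-ORDER twin of the slice calculus' first-variation
# shape — along a ray `s ↦ sX` of the gauge-fixed coordinates, `d²∕ds² g(sX)∣₀ = ⟪X, D(∇g)(0)X⟫`, the Hessian PAIRING in which the N12∕s1 chain's letter `hlead` is typed

statement-level skeleton of published theorems with citation tags; proofs where landed; nothing here is a claim about
the Yang–Mills mass gap

Cell `pub-ymgap`, WIDTH SEAT `pub-ymgap-dag-n12-w2` generation 0 (HUMAN RULING D-0149 ∕ director-ym №197; DAG node N12 = [B15]; successor piece (S1) after W-SEAT-START-LIST v2 §N12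
ITEM 2 = U2a, on the lane's word).  CONSUMED BY NAME: dag-n12-c's `B15Prop1SliceTaylorCalculus` (`GaugeSlice`, `rGrad`, `rieszR`, `inner_rGrad`, `hasDerivAt_line_rGrad` — the first-order
shape).  `--kind proof --supports stmt-QuantumFields-20542` (K1⁷; count-neutral).

PRINT.  [Balaban1989LargeFieldII] p. 359: «We expand the function with respect to B′ … Now the condition for a critical configuration is the equation ⟨δB′, H_{1,k}J_{k,Z}⟩ +
⟨δB′, H_{1,k}Δ₁H_{1,k}B′⟩ + ⟨δB′, H_{1,k}(δ∕δA)V(H_{1,k}B′)⟩ = 0 (1.12)»; p. 358 (1.7)–(1.9): the quadratic form `⟨H_{1,k}B′, Δ₁(ζ₀)H_{1,k}B′⟩` — the DIAGONAL of the Hessian of the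
function of `B′`.  The N12∕s1 chain (`B15Prop1Thm1GeneralFormShapes` :582) types it as `⟪X, (fderiv ℝ (rGrad … (sliceFn … f (ext Vk))) 0) X⟫`; the U2a files
(`Node00.WilsonActionSecondVariation{,Expansion,Curve,NearFlat}`) deliver second derivatives ALONG RAYS∕CURVES, `deriv (deriv (A ∘ γ)) 0`.  This file is the one-line bridge.

CONTENTS (theorems only; no `def`).  For `g : GaugeSlice S T E3 → ℝ` differentiable near `0` with `rGrad S T g` differentiable at `0`, and a direction `X`:
* `hasDerivAt_line_rGrad'` — at every `s` with `g` differentiable at `sX`: `d∕ds g(sX) = ⟪X, ∇g(sX)⟫` (the first-order shape off the origin);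
* ★ `hasDerivAt_inner_rGrad_line` — `s ↦ ⟪X, ∇g(sX)⟫` has derivative `⟪X, D(∇g)(0)X⟫` at `0`;
* ★★★ `hasDerivAt_deriv_smul_inner_rGrad` ∕ `deriv_deriv_smul_eq_inner_rGrad` — `HasDerivAt (deriv fun s => g (s • X)) ⟪X, fderiv ℝ (rGrad S T g) 0 X⟫ 0`, i.e.
  `d²∕ds² g(sX)∣₀ = ⟪X, D(∇g)(0)X⟫` (in the `rGrad` currency of the chain; dag-n12-w3's `B11Eq177CriticalFamilyDerivative.hasDerivAt_deriv_smul` is the twin in the Fréchet-Hessian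
  currency `D²g(0)(X,X)`, and `inner_fderiv_rGrad` below identifies the two);
* `hasFDerivAt_rGrad_of_fderiv`, ★ `inner_fderiv_rGrad` — if `Dg` is differentiable at `0`: `D(∇g)(0)Y = rieszR (D²g(0)Y)` and `⟪X, D(∇g)(0)Y⟫ = D²g(0)(Y)(X)`.

HONEST SCOPE.  Pure finite-dimensional calculus (chain rule twice); nothing of Bałaban's is asserted; count-neutral; NOT a discharge of N12; NOT summit progress; nothing continuum ∕ OS ∕
mass-gap ∕ Clay.
-/

noncomputable section

open Set Metric Filter
open scoped InnerProductSpace Topology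

namespace Literature.MathematicalPhysics.QuantumFieldTheory.Balaban1983to89.B15Prop1SliceSecondDerivative

open B15Prop1SliceCoordinates (GaugeSlice)
open B15Prop1SliceTaylorCalculus (rGrad rieszR inner_rGrad inner_rieszR)
open B15Prop1ChartCalculusSU2 (E3)

variable {P : Params} {k : ℕ} [DecidableEq (PBond P k)] (S : Set (Site P k)) (T : Finset (PBond P k))

/-- **THE FIRST-ORDER SHAPE OFF THE ORIGIN**: if `g` is differentiable at `sX` then `d∕ds g(sX) = ⟪X, ∇g(sX)⟫` (dag-n12-c's `hasDerivAt_line_rGrad` is the case through a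
base point with `s = 0`). [cite: Balaban1989LargeFieldII, (1.12) p.359] -/
theorem hasDerivAt_line_rGrad' {g : GaugeSlice S T E3 → ℝ} {X : GaugeSlice S T E3} {s : ℝ} (hg : DifferentiableAt ℝ g (s • X)) :
    HasDerivAt (fun r : ℝ => g (r • X)) ⟪X, rGrad S T g (s • X)⟫_ℝ s := by
  haveI : ContinuousSMul ℝ (GaugeSlice S T E3) := IsBoundedSMul.continuousSMul
  have hline : HasDerivAt (fun r : ℝ => r • X) X s := by simpa using (hasDerivAt_id s).smul_const X
  have h := hg.hasFDerivAt.comp_hasDerivAt s hline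
  rw [inner_rGrad]
  exact h

/-- ★ **THE PAIRED GRADIENT ALONG THE RAY**: if `rGrad S T g` is differentiable at `0`, then `s ↦ ⟪X, ∇g(sX)⟫` has derivative `⟪X, D(∇g)(0)X⟫` at `s = 0`.
[cite: Balaban1989LargeFieldII, (1.12) p.359, (1.7) p.358] -/
theorem hasDerivAt_inner_rGrad_line {g : GaugeSlice S T E3 → ℝ} (X : GaugeSlice S T E3) (h2 : DifferentiableAt ℝ (rGrad S T g) 0) :
    HasDerivAt (fun s : ℝ => ⟪X, rGrad S T g (s • X)⟫_ℝ) ⟪X, fderiv ℝ (rGrad S T g) 0 X⟫_ℝ 0 := by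
  haveI : ContinuousSMul ℝ (GaugeSlice S T E3) := IsBoundedSMul.continuousSMul
  have hline : HasDerivAt (fun r : ℝ => r • X) X 0 := by simpa using (hasDerivAt_id (0 : ℝ)).smul_const X
  have hγ : HasDerivAt (fun s : ℝ => rGrad S T g (s • X)) (fderiv ℝ (rGrad S T g) 0 X) 0 :=
    h2.hasFDerivAt.comp_hasDerivAt_of_eq (0 : ℝ) hline (by simp)
  have h := (hasDerivAt_const (0 : ℝ) X).inner ℝ hγ
  simpa only [inner_zero_left, add_zero] using h

/-- ★★★ **THE SECOND DERIVATIVE ALONG A RAY IS THE HESSIAN PAIRING**: for `g` differentiable near `0` with `rGrad S T g` differentiable at `0`,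
`HasDerivAt (deriv fun s => g (s • X)) ⟪X, D(∇g)(0)X⟫ 0` — the bridge from the U2a ray∕curve second variations (`deriv (deriv (A ∘ γ)) 0`, this seat's
`Node00.WilsonActionSecondVariation*`) to the pairing `⟪X, (fderiv ℝ (rGrad …) 0) X⟫` of the chain's letter `hlead`. [cite: Balaban1989LargeFieldII, (1.12) p.359, (1.7) p.358] -/
theorem hasDerivAt_deriv_smul_inner_rGrad {g : GaugeSlice S T E3 → ℝ} (X : GaugeSlice S T E3) (hg : ∀ᶠ Y in 𝓝 (0 : GaugeSlice S T E3), DifferentiableAt ℝ g Y)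
    (h2 : DifferentiableAt ℝ (rGrad S T g) 0) :
    HasDerivAt (deriv fun s : ℝ => g (s • X)) ⟪X, fderiv ℝ (rGrad S T g) 0 X⟫_ℝ 0 := by
  haveI : ContinuousSMul ℝ (GaugeSlice S T E3) := IsBoundedSMul.continuousSMul
  -- near `s = 0`, `sX` is near `0`, so `deriv (g ∘ ray) s = ⟪X, ∇g(sX)⟫`
  have hline : HasDerivAt (fun r : ℝ => r • X) X 0 := by simpa using (hasDerivAt_id (0 : ℝ)).smul_const X
  have hray : Tendsto (fun s : ℝ => s • X) (𝓝 0) (𝓝 0) := by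
    simpa only [zero_smul] using hline.continuousAt.tendsto
  have hev : (deriv fun s : ℝ => g (s • X)) =ᶠ[𝓝 0] fun s => ⟪X, rGrad S T g (s • X)⟫_ℝ :=
    (hray.eventually hg).mono fun s hs => (hasDerivAt_line_rGrad' S T hs).deriv
  exact (hasDerivAt_inner_rGrad_line S T X h2).congr_of_eventuallyEq hev

/-- ★★★ **VALUE FORM**: `d²∕ds² g(sX)∣₀ = ⟪X, D(∇g)(0)X⟫`. [cite: Balaban1989LargeFieldII, (1.12) p.359, (1.7) p.358] -/
theorem deriv_deriv_smul_eq_inner_rGrad {g : GaugeSlice S T E3 → ℝ} (X : GaugeSlice S T E3) (hg : ∀ᶠ Y in 𝓝 (0 : GaugeSlice S T E3), DifferentiableAt ℝ g Y)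
    (h2 : DifferentiableAt ℝ (rGrad S T g) 0) :
    deriv (deriv fun s : ℝ => g (s • X)) 0 = ⟪X, fderiv ℝ (rGrad S T g) 0 X⟫_ℝ :=
  (hasDerivAt_deriv_smul_inner_rGrad S T X hg h2).deriv

/-- The gradient map is the Riesz map after the derivative: if `Dg` has a derivative at `0`, then so has `∇g = rieszR ∘ Dg`, namely `rieszR ∘ D²g(0)`.
[cite: Balaban1989LargeFieldII, (1.12) p.359 (bookkeeping)] -/
theorem hasFDerivAt_rGrad_of_fderiv {g : GaugeSlice S T E3 → ℝ} {g₂ : GaugeSlice S T E3 →L[ℝ] GaugeSlice S T E3 →L[ℝ] ℝ}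
    (h : HasFDerivAt (fun Y => fderiv ℝ g Y) g₂ 0) : HasFDerivAt (rGrad S T g) ((rieszR S T).comp g₂) 0 := by
  haveI : ContinuousSMul ℝ (GaugeSlice S T E3) := IsBoundedSMul.continuousSMul
  rw [B15Prop1SliceTaylorCalculus.rGrad_def]
  exact (rieszR S T).hasFDerivAt.comp (0 : GaugeSlice S T E3) h

/-- ★ **THE TWO HESSIAN CURRENCIES AGREE**: if `Dg` has derivative `g₂ = D²g(0)` at `0`, then `⟪X, D(∇g)(0)Y⟫ = D²g(0)(Y)(X)` — so the pairing of the chain's `hlead`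
(`⟪X, (fderiv ℝ (rGrad …) 0) X⟫`) is the diagonal `D²g(0)(X,X)` of dag-n12-w3's `hasDerivAt_deriv_smul`, and both are the ray second derivative `d²∕ds² g(sX)∣₀`.
[cite: Balaban1989LargeFieldII, (1.12) p.359, (1.7) p.358] -/
theorem inner_fderiv_rGrad {g : GaugeSlice S T E3 → ℝ} {g₂ : GaugeSlice S T E3 →L[ℝ] GaugeSlice S T E3 →L[ℝ] ℝ}
    (h : HasFDerivAt (fun Y => fderiv ℝ g Y) g₂ 0) (X Y : GaugeSlice S T E3) :
    ⟪X, fderiv ℝ (rGrad S T g) 0 Y⟫_ℝ = g₂ Y X := by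
  haveI : ContinuousSMul ℝ (GaugeSlice S T E3) := IsBoundedSMul.continuousSMul
  rw [(hasFDerivAt_rGrad_of_fderiv S T h).fderiv, ContinuousLinearMap.comp_apply, inner_rieszR]

end Literature.MathematicalPhysics.QuantumFieldTheory.Balaban1983to89.B15Prop1SliceSecondDerivative

end
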